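import Summits.MatrixMultiplication.OmegaCensus.CycloBlocks7
import Summits.MatrixMultiplication.OmegaCensus.ZetaCheck

/-!
# ω-census, family (b3): conjecture C9 — `(ℤ[ζ₇]/p) ⋊ C₇`: the `p`-INDEPENDENT decidable check and the generic theorem

HONEST FRAMING (pub-omega census; verbatim): lottery ticket; floor = certified bounds/negative ranges.
Census BOOKKEEPING (conjecture C9 of the cell; pub-omega stpp-1 gen 22).  `ZetaCheck.lean` for `q = 7` (six coordinates, levels in
`ℤ/7`): box `Y = {1, a^α, b}`, `W = {1, a^β, b^t}` with `α = A/2`, `β = B/2`, `A, B ∈ ℤ⁶`; every coordinate of every product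
`ζ^s α`, `ζ^s β` is `g/2` with the explicit integer `g = (lzpow7 s A) k` (`CycloRing7.act_zeta_toC`), so errors are exact constants and
phases are `≡ error (mod 2)` for every odd `p` (`ZetaArcs.two_val_div`, `phase_residue2`).  `col7/lin7/map_lin7` (the `q = 7` copy of
`GoldArcs.lin`), `coef7`, `ZData7` / **`ZData7.OK Emax`** (decidable, independent of `p`), **`exists_indep7`**,
**`not_boxUseful_of_count7`** (exact count) and **`not_boxUseful_of_unif7`** (`576 p⁶ ≤ 5·MIS·(p − 5)⁶` when all trims are `≤ 4`).
Data and theorems: `Cyclo7All.lean`.  Nothing here is progress on `ω`.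
-/

namespace Summit.MatrixMultiplication.OmegaCensus

open Finset

namespace Cyclo7

open ZetaArcs (PairOK2 OK2 two_val_div phase_residue2 bLen2 two_mul_bLen2_ge)
open EisArcs (PhiR)

/-! ### Levels in `ℤ/7` -/

/-- Data supported on the middle `Y`/`W`-element. [folklore] -/
def col7 {R : Type*} [Zero R] (a : ZMod 7 → R) : ZMod 7 → Fin 3 → R := fun s i => if i = 1 then a s else 0

/-- The four-term signed sum for the box `Y = {1, a^α, b}`, `W = {1, a^β, b^t}`, levels `(0,0,1)`, `(0,0,t)` in `ℤ/7`. [folklore] -/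
def lin7 {R : Type*} [AddCommGroup R] (t : ZMod 7) (a b : ZMod 7 → R) (c c' : Fin 3 × Fin 3) : R :=
  col7 a ((![0, 0, 1] : Fin 3 → ZMod 7) c.1 + (![0, 0, t] : Fin 3 → ZMod 7) c'.2) c'.1
    - col7 b ((![0, 0, 1] : Fin 3 → ZMod 7) c.1 + (![0, 0, t] : Fin 3 → ZMod 7) c'.2) c.2
    + col7 b ((![0, 0, 1] : Fin 3 → ZMod 7) c.1 + (![0, 0, t] : Fin 3 → ZMod 7) c.2) c'.2
    - col7 a ((![0, 0, 1] : Fin 3 → ZMod 7) c'.1 + (![0, 0, t] : Fin 3 → ZMod 7) c'.2) c.1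

/-- `lin7` commutes with additive maps. [folklore] -/
theorem map_lin7 {R S : Type*} [AddCommGroup R] [AddCommGroup S] (g : R →+ S) (t : ZMod 7) (a b : ZMod 7 → R)
    (c c' : Fin 3 × Fin 3) : g (lin7 t a b c c') = lin7 t (g ∘ a) (g ∘ b) c c' := by
  simp only [lin7, col7, map_sub, map_add, Function.comp_apply]
  split_ifs <;> simp only [map_zero]

/-! ### Coefficient vectors and the check -/

/-- Coordinate vectors of `ζ^s · V`. [folklore] -/
def gZ7 (V : Fin 6 → ℤ) : ZMod 7 → Fin 6 → ℤ := fun s => Z7.lzpow7 s.val V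

/-- The coefficient vector of the column pair `(c, c')`: exact errors `E_k`, phases `≡ E_k (mod 2)`. [folklore] -/
def coef7 (A B : Fin 6 → ℤ) (t : ZMod 7) (c c' : Fin 3 × Fin 3) : Fin 6 → ℤ := lin7 t (gZ7 A) (gZ7 B) c c'

/-- A coordinate vector is *small nonzero*: some nonzero component, all components in `[−2, 2]`. [folklore] -/
def SmallNZ7 (v : Fin 6 → ℤ) : Prop := (∃ k, v k ≠ 0) ∧ ∀ k, |v k| ≤ 2

/-- `SmallNZ7` is decidable. [folklore] -/
instance (v : Fin 6 → ℤ) : Decidable (SmallNZ7 v) := by unfold SmallNZ7; infer_instance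

/-- The datum: box `(A, B, t)`, phase vectors per column, trims. [folklore] -/
structure ZData7 where
  /-- coordinates of `2α` -/
  A : Fin 6 → ℤ
  /-- coordinates of `2β` -/
  B : Fin 6 → ℤ
  /-- the `b`-exponent of the third `W`-element -/
  t : ZMod 7
  /-- phase vectors (in `{0,1}⁶`) used per column -/
  P : Fin 3 × Fin 3 → Finset (Fin 6 → ℤ)
  /-- bottom trims -/
  lo : Fin 3 × Fin 3 → (Fin 6 → ℤ) → Fin 6 → ℕ
  /-- top trims -/
  hi : Fin 3 × Fin 3 → (Fin 6 → ℤ) → Fin 6 → ℕ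

namespace ZData7

variable (zd : ZData7)

/-- Number of blocks. [folklore] -/
def MIS : ℕ := ∑ c, #(zd.P c)

/-- The exact cell count at the prime `p`. [folklore] -/
def count (p : ℕ) : ℕ := ∑ c, ∑ φ ∈ zd.P c, blkCount7 p φ (zd.lo c φ) (zd.hi c φ)

/-- **The check** (independent of `p`). [folklore] -/
def OK (Emax : ℕ) : Prop :=
  SmallNZ7 zd.A ∧ SmallNZ7 zd.B ∧ zd.t ≠ 0 ∧ (∀ c, ∀ φ ∈ zd.P c, ∀ k, 0 ≤ φ k ∧ φ k < 2) ∧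
    (∀ c c', c ≠ c' → ∀ k, |coef7 zd.A zd.B zd.t c c' k| ≤ Emax) ∧
    (∀ c c', c ≠ c' → ∀ φ ∈ zd.P c, ∀ φ' ∈ zd.P c', ∃ k : Fin 6,
      OK2 (coef7 zd.A zd.B zd.t c c' k) (φ k) (φ' k) (zd.lo c φ k) (zd.hi c φ k) (zd.lo c' φ' k) (zd.hi c' φ' k))

/-- The check is decidable. [folklore] -/
instance (Emax : ℕ) : Decidable (zd.OK Emax) := by unfold OK; infer_instance

end ZData7

/-! ### The generic theorem -/

variable {p : ℕ}

/-- **Independence.** A passed check with `2·Emax < p` (`p` an odd prime) gives a nondegenerate box of `(ℤ[ζ₇]/p) ⋊ ℤ/7` whose 6-D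
arc set is an independent pattern. [folklore] -/
theorem exists_indep7 [Fact p.Prime] (hp : 3 ≤ p) (zd : ZData7) {Emax : ℕ} (hok : zd.OK Emax) (hE : 2 * Emax < p) :
    haveI : NeZero p := ⟨(Fact.out : p.Prime).ne_zero⟩
    haveI : Fact (1 < p) := ⟨(Fact.out : p.Prime).one_lt⟩
    ∃ D : RCyc.RBox (Z7 p) 7, D.Nondeg Z7.zeta ∧ D.PatIndep Z7.zeta (blockArcSet7 p zd.P zd.lo zd.hi) := by
  have hprime : p.Prime := Fact.out
  haveI : NeZero p := ⟨hprime.ne_zero⟩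
  haveI : Fact (1 < p) := ⟨hprime.one_lt⟩
  obtain ⟨A, B, t, P, lo, hi⟩ := zd
  obtain ⟨hA, hB, ht, hP, hEm, hpair⟩ := hok
  dsimp only at hA hB ht hP hEm hpair ⊢
  have hodd : Odd p := hprime.odd_of_ne_two (by omega)
  have h2 : (2 : ZMod p) ≠ 0 := by
    intro h
    have h' : ((2 : ℕ) : ZMod p) = 0 := by exact_mod_cast h
    rw [ZMod.natCast_eq_zero_iff] at h'
    have := Nat.le_of_dvd two_pos h'
    omega
  set ι : ZMod p := (2 : ZMod p)⁻¹ with hι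
  have hι0 : ι ≠ 0 := inv_ne_zero h2
  -- the box
  set D : RCyc.RBox (Z7 p) 7 := ⟨![0, Z7.toC ι A, 0], ![0, 0, 1], ![0, Z7.toC ι B, 0], ![0, 0, t]⟩ with hD
  -- phases and errors per coordinate
  choose a ha using fun (V : Fin 6 → ℤ) (k : Fin 6) (s : ZMod 7) => two_val_div h2 (gZ7 V s k)
  set e : (Fin 6 → ℤ) → Fin 6 → ZMod 7 → ℤ := fun V k s => gZ7 V s k with he
  have hcoord : ∀ V k s, 2 * (((RCyc.act Z7.zeta s * Z7.toC ι V).v k).val : ℤ) = a V k s * p + e V k s := by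
    intro V k s
    rw [Z7.act_zeta_toC]
    exact ha V k s
  have hzero : ∀ (s : ZMod 7) (k : Fin 6), 2 * (((RCyc.act Z7.zeta s * (0 : Z7 p)).v k).val : ℤ) = 0 := by
    intro s k
    rw [mul_zero, Z7.zero_v]
    simp
  have hα : ∀ k s i, 2 * (((RCyc.act Z7.zeta s * D.α i).v k).val : ℤ) = col7 (a A k) s i * p + col7 (e A k) s i := by
    intro k s i
    fin_cases i
    · simpa [hD, col7] using hzero s k
    · simpa [hD, col7] using hcoord A k s
    · simpa [hD, col7] using hzero s k
  have hβ : ∀ k s j, 2 * (((RCyc.act Z7.zeta s * D.β j).v k).val : ℤ) = col7 (a B k) s j * p + col7 (e B k) s j := by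
    intro k s j
    fin_cases j
    · simpa [hD, col7] using hzero s k
    · simpa [hD, col7] using hcoord B k s
    · simpa [hD, col7] using hzero s k
  have hPhi : ∀ (u v : ZMod 7 → ℤ) (c c' : Fin 3 × Fin 3), PhiR D (col7 u) (col7 v) c c' = lin7 t u v c c' := by
    intro u v c c'; rfl
  -- `Φ_k ≡ E_k (mod 2)` and `E_k = coef k`
  have hres : ∀ V k s, ((a V k s : ℤ) : ZMod 2) = ((e V k s : ℤ) : ZMod 2) := fun V k s => phase_residue2 hodd (ha V k s)
  have hmod : ∀ k c c', ((lin7 t (a A k) (a B k) c c' : ℤ) : ZMod 2) = ((lin7 t (e A k) (e B k) c c' : ℤ) : ZMod 2) := by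
    intro k c c'
    have h1 := map_lin7 (Int.castAddHom (ZMod 2)) t (a A k) (a B k) c c'
    have h2 := map_lin7 (Int.castAddHom (ZMod 2)) t (e A k) (e B k) c c'
    simp only [Int.coe_castAddHom] at h1 h2
    rw [h1, h2]
    congr 1 <;> funext s <;> simp only [Function.comp_apply, hres]
  have herr : ∀ k c c', lin7 t (e A k) (e B k) c c' = coef7 A B t c c' k := by
    intro k c c'
    have := map_lin7 (Pi.evalAddMonoidHom (fun _ : Fin 6 => ℤ) k) t (gZ7 A) (gZ7 B) c c'
    rw [coef7, show (lin7 t (gZ7 A) (gZ7 B) c c') k = Pi.evalAddMonoidHom (fun _ : Fin 6 => ℤ) k (lin7 t (gZ7 A) (gZ7 B) c c')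
      from rfl, this]
    rfl
  have hpar : ∀ k c c', (lin7 t (a A k) (a B k) c c' - coef7 A B t c c' k) % 2 = 0 := by
    intro k c c'
    rw [← herr]
    have h := (ZMod.intCast_eq_intCast_iff_dvd_sub _ _ 2).1 (hmod k c c').symm
    exact Int.emod_eq_zero_of_dvd (by exact_mod_cast h)
  -- the pair condition
  have hcond : ∀ c c', c ≠ c' → ∀ φ ∈ P c, ∀ φ' ∈ P c', ∃ k : Fin 6,
      PairOK2 p (PhiR D (col7 (a A k)) (col7 (a B k)) c c') (PhiR D (col7 (e A k)) (col7 (e B k)) c c') (φ k) (φ' k)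
        ((lo c φ k : ℕ) : ℤ) ((hi c φ k : ℕ) : ℤ) ((lo c' φ' k : ℕ) : ℤ) ((hi c' φ' k : ℕ) : ℤ) := by
    intro c c' hcc φ hφ φ' hφ'
    obtain ⟨k, h0, hplus, hminus⟩ := hpair c c' hcc φ hφ φ' hφ'
    refine ⟨k, ?_, ?_, ?_, ?_⟩
    · rw [hPhi, herr]
      have h1 := hEm c c' hcc k
      have h2 : (Emax : ℤ) * 2 < p := by exact_mod_cast (by omega : Emax * 2 < p)
      linarith [abs_nonneg (coef7 A B t c c' k)]
    · rw [hPhi]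
      intro h; apply h0
      have := hpar k c c'
      omega
    · rw [hPhi, herr]
      intro hpos
      rcases hplus hpos with h | h
      · exact Or.inl (by exact_mod_cast h)
      · exact Or.inr (by exact_mod_cast h)
    · rw [hPhi, herr]
      intro hneg
      rcases hminus hneg with h | h
      · exact Or.inl (by exact_mod_cast h)
      · exact Or.inr (by exact_mod_cast h)
  -- independence
  have indep : D.PatIndep Z7.zeta (blockArcSet7 p P lo hi) :=
    (patIndep_blockCells7 D (fun k => col7 (a A k)) (fun k => col7 (e A k)) (fun k => col7 (a B k)) (fun k => col7 (e B k))
      hα hβ P lo hi hcond).anti (blockArcSet7_subset hP)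
  -- nondegeneracy
  have hnz : ∀ {V : Fin 6 → ℤ}, SmallNZ7 V → Z7.toC ι V ≠ (0 : Z7 p) := by
    rintro V ⟨⟨k, hk⟩, hsmall⟩ h0
    have h1 : (Z7.toC ι V).v k = (0 : Z7 p).v k := by rw [h0]
    rw [Z7.zero_v, Pi.zero_apply, Z7.toC] at h1
    dsimp only at h1
    rcases mul_eq_zero.1 h1 with h1 | h1
    · rw [ZMod.intCast_zmod_eq_zero_iff_dvd] at h1
      have hle := Int.le_of_dvd (abs_pos.2 hk) ((dvd_abs _ _).2 h1)
      have := hsmall k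
      have : (3 : ℤ) ≤ p := by exact_mod_cast hp
      omega
    · exact hι0 h1
  have hα0 := hnz hA
  have hβ0 := hnz hB
  have hD' : D.Nondeg Z7.zeta := by
    refine D.nondeg_of Z7.zeta ?_ ?_
    · intro i i' h
      simp only [hD, Prod.mk.injEq] at h
      obtain ⟨h1, h2⟩ := h
      fin_cases i <;> fin_cases i' <;> simp (decide := true) [hα0, hα0.symm] at h1 h2 ⊢
    · intro j j' h
      simp only [hD, Prod.mk.injEq] at h
      obtain ⟨h1, h2⟩ := h
      fin_cases j <;> fin_cases j' <;> simp (decide := true) [hβ0, hβ0.symm, ht, ht.symm] at h1 h2 ⊢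
  exact ⟨D, hD', indep⟩

/-- **`¬ BoxUseful` from the check and the exact count** (decidable per prime). [folklore] -/
theorem not_boxUseful_of_count7 [Fact p.Prime] [Fact (1 < p)] (hp : 3 ≤ p) (zd : ZData7) {Emax : ℕ} (hok : zd.OK Emax)
    (hE : 2 * Emax < p) (hbig : 9 * p ^ 6 ≤ 5 * zd.count p) : ¬ BoxUseful (Z7Cyc p) := by
  haveI : NeZero p := ⟨(Fact.out : p.Prime).ne_zero⟩
  obtain ⟨D, hD, indep⟩ := exists_indep7 hp zd hok hE
  refine D.not_boxUseful_of_pattern Z7.zeta hD indep ?_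
  obtain ⟨-, -, -, hP, -, -⟩ := hok
  rw [Z7.card, card_blockArcSet7 hP]
  exact hbig

/-- **`¬ BoxUseful` from the check and the UNIFORM count** `576 p⁶ ≤ 5·MIS·(p − 5)⁶` (all trims `lo + hi ≤ 4`, `p ≥ 5`). [folklore] -/
theorem not_boxUseful_of_unif7 [Fact p.Prime] [Fact (1 < p)] (hp : 5 ≤ p) (zd : ZData7) {Emax : ℕ} (hok : zd.OK Emax)
    (hE : 2 * Emax < p) (htrim : ∀ c, ∀ φ ∈ zd.P c, ∀ k, zd.lo c φ k + zd.hi c φ k ≤ 4)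
    (hunif : 576 * (p : ℤ) ^ 6 ≤ 5 * zd.MIS * ((p : ℤ) - 5) ^ 6) : ¬ BoxUseful (Z7Cyc p) := by
  refine not_boxUseful_of_count7 (by omega) zd hok hE ?_
  obtain ⟨A, B, t, P, lo, hi⟩ := zd
  dsimp only at htrim hunif ⊢
  simp only [ZData7.count, ZData7.MIS] at hunif ⊢
  have hp5 : (5 : ℤ) ≤ p := by exact_mod_cast hp
  have hlen : ∀ (φk : ℤ) (l h : ℕ), l + h ≤ 4 → (p : ℤ) - 5 ≤ 2 * ((bLen2 p φk l h).toNat : ℤ) := by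
    intro φk l h hlh
    have e1 := two_mul_bLen2_ge (p := p) φk l h
    have t1 : bLen2 p φk l h ≤ ((bLen2 p φk l h).toNat : ℤ) := Int.self_le_toNat _
    have : ((l : ℕ) : ℤ) + h ≤ 4 := by exact_mod_cast hlh
    linarith
  have hblock : ∀ c, ∀ φ ∈ P c, ((p : ℤ) - 5) ^ 6 ≤ 64 * ((blkCount7 p φ (lo c φ) (hi c φ) : ℕ) : ℤ) := by
    intro c φ hφ
    have hq : 0 ≤ (p : ℤ) - 5 := by linarith
    have g : ∀ k, (p : ℤ) - 5 ≤ 2 * ((bLen2 p (φ k) (lo c φ k) (hi c φ k)).toNat : ℤ) :=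
      fun k => hlen (φ k) (lo c φ k) (hi c φ k) (htrim c φ hφ k)
    simp only [blkCount7]
    push_cast
    rw [Fin.prod_univ_six]
    have m1 := mul_le_mul (g 0) (g 1) hq (by positivity)
    have m2 := mul_le_mul m1 (g 2) hq (by positivity)
    have m3 := mul_le_mul m2 (g 3) hq (by positivity)
    have m4 := mul_le_mul m3 (g 4) hq (by positivity)
    have m5 := mul_le_mul m4 (g 5) hq (by positivity)
    nlinarith [m5]
  have htot : ((∑ c, #(P c) : ℕ) : ℤ) * ((p : ℤ) - 5) ^ 6 ≤
      64 * ((∑ c, ∑ φ ∈ P c, blkCount7 p φ (lo c φ) (hi c φ) : ℕ) : ℤ) := by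
    rw [Nat.cast_sum, Nat.cast_sum, Finset.sum_mul, Finset.mul_sum]
    refine Finset.sum_le_sum fun c _ => ?_
    rw [Nat.cast_sum, Finset.mul_sum]
    have : (#(P c) : ℤ) * ((p : ℤ) - 5) ^ 6 = ∑ φ ∈ P c, ((p : ℤ) - 5) ^ 6 := by rw [Finset.sum_const, nsmul_eq_mul]
    rw [this]
    exact Finset.sum_le_sum fun φ hφ => hblock c φ hφ
  have hfin : 9 * (p : ℤ) ^ 6 ≤ 5 * ((∑ c, ∑ φ ∈ P c, blkCount7 p φ (lo c φ) (hi c φ) : ℕ) : ℤ) := by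
    nlinarith [htot, hunif]
  exact_mod_cast hfin

end Cyclo7

end Summit.MatrixMultiplication.OmegaCensus
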